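import Summits.BirchSwinnertonDyer.BirchSwinnertonDyer.Theorems.ManinLocalTwoThreeCuspidalKummerOddExponentOfOddManin
import Summits.BirchSwinnertonDyer.BirchSwinnertonDyer.Theorems.ManinLocalTwoThreeKummerSquareOfBlind
import HarnessLib

/-!
# The cuspidal-Kummer certificate is SILENT at Kummer-blind points: blind `T` ⟹ every `η`-exponent is even

Summit `BirchSwinnertonDyer`, route `ManinLocalTwoThree` (cell bsd-f2-manin), crux C2 `ManinOddAtFour` (stmt-BirchSwinnertonDyer-22967),
line `kato_shift_two`, skeleton v10.  Why the ORBIT-MINIMAL TOTALLY-BLIND residual (`stub_blindOrbitMinimalResidual`) is a genuine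
residual of an's cuspidal-Kummer programme and not an artefact of the typing: at a Kummer-blind rational 2-torsion point `T`
(`KummerBlindAtTwo a₂ a₄ e`) the Kummer series `Ξ_T` is ALWAYS a square in `Frac ℤ₂⟦q⟧` — whatever the Manin constant —
(`isTwoAdicFracSquare_kummerSeries_of_kummerBlind`; the converse half of an's E-an-54 «blind ⟺ Kummer class trivial»), hence
every cuspidal Kummer representative of `T` has ALL `η`-exponents even (`forall_even_etaExponent_of_kummerBlind`): the certificate
E-an-52 (`ManinOddOfOddEtaExponent`, «some odd exponent ⟹ 2 ∤ c») can never fire at a blind point.  Together with the lead's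
`exists_odd_etaExponent_of_not_kummerBlind_of_odd_maninConstant` this gives, at ODD `c` and given a representative (K_geo),
**blind ⟺ all exponents even** (`kummerBlindAtTwo_iff_forall_even_of_odd_maninConstant`) — an's conjectural dictionary E-an-51/54
«blind ⟺ parity vector 0» as a theorem on the odd-`c` locus.

MECHANISM: blind ⟹ `2 ∣ ε`, `16 ∣ ε² − 4(ε² + a₄♮)` in `ℤ₂` (`ε = e + a₂/3` on `E♮ = shortModel W 1`) ⟹ (Catalan square root,
`…KummerSquareOfBlind`) `Q = X² + εt²X + (ε² + a₄♮)t⁴ = G²` in `ℤ₂⟦t⟧` ⟹ with the chart identity `κ·Q = X²`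
(`…KummerSquareCriterion`): `κ·G² = X²`, and reading at the `2`-integral germ `D` (`Ξ = κ(D)`): `Ξ·G(D)² = X(D)²`.
Nothing about BSD or Manin's conjecture is proved here. [folklore]
-/

set_option autoImplicit false
set_option linter.dupNamespace false

noncomputable section

open scoped Classical
open PowerSeries WeierstrassCurve Literature.NumberTheory.EllipticCurves Literature.NumberTheory.EllipticCurves.ModularForms
  Literature.RingTheory.FormalGroups
open Summit.BirchSwinnertonDyer.Rank1Residual.ManinAdditive
open Summit.BirchSwinnertonDyer.Rank1Residual.ManinAdditive.CuspidalKummer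

namespace Summit.BirchSwinnertonDyer.BirchSwinnertonDyer.Theorems.ManinLocalTwoThree

section Silent

/-- **A Kummer-blind point has square Kummer class, for every Manin constant** (converse half of an's E-an-54): for globally
minimal elliptic `W` with `a₁ = a₃ = 0` and integer `a₂, a₄`, a datum `D` at a level `N` with `4 ∣ N`, integral newform coefficients,
an integral root `e` with `KummerBlindAtTwo a₂ a₄ e`, and the formal germ `z`: `Ξ_T` is a square in `Frac ℤ₂⟦q⟧`. [folklore] -/
theorem isTwoAdicFracSquare_kummerSeries_of_kummerBlind
    (W : WeierstrassCurve ℚ) [hWell : W.IsElliptic] [W.IsGloballyMinimal] {N : ℕ} [NeZero N]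
    (D : ModularParametrizationData W N) (a : ℕ → ℤ) (ha : ∀ n, (a n : ℂ) = cuspCoeff D.f n)
    (h4 : 4 ∣ N) (a₂ a₄ e : ℤ) (hW₁ : W.a₁ = 0) (hW₃ : W.a₃ = 0) (hW₂ : W.a₂ = a₂) (hW₄ : W.a₄ = a₄)
    (he : W.twoTorsionPolynomial.toPoly.IsRoot (e : ℚ))
    (z : ℚ⟦X⟧) (hz : IsParamGerm W D.c a z) (hbl : KummerBlindAtTwo a₂ a₄ e) :
    IsTwoAdicFracSquare (kummerSeries W D.c e z) := by
  obtain ⟨hz0, hlog⟩ := hz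
  have hc0 : D.c ≠ 0 := D.maninConstant_ne_zero_holds
  -- §5-type arithmetic at `2`
  obtain ⟨ha2, hN2⟩ := lFunction_two_eq_zero_of_four_dvd W D.isNewformOf h4
  have han : ∀ n, a n = W.LFunction n := fun n => by
    have h := ha n; rw [D.isNewformOf.2 n] at h; exact_mod_cast h
  obtain ⟨a₆, hW₆⟩ : ∃ a₆ : ℤ, W.a₆ = a₆ := by
    refine ⟨(integralModelInt W).a₆, ?_⟩
    conv_lhs => rw [← map_integralModelInt W]
    rw [map_a₆, eq_intCast]
  -- the `2`-integral short model `E♮ = shortModel W 1`: `a₄♮ = −κ/3`, `a₆♮ = −μ/27`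
  set κ : ℤ := a₂ ^ 2 - 3 * a₄ with hκ
  set μ : ℤ := -2 * a₂ ^ 3 + 9 * a₂ * a₄ - 27 * a₆ with hμ
  have hWc₄ : W.c₄ = ((16 * κ : ℤ) : ℚ) := by
    simp only [WeierstrassCurve.c₄, WeierstrassCurve.b₂, WeierstrassCurve.b₄, hW₁, hW₃, hW₂, hW₄, hκ]
    push_cast; ring
  have hWc₆ : W.c₆ = ((32 * μ : ℤ) : ℚ) := by
    simp only [WeierstrassCurve.c₆, WeierstrassCurve.b₂, WeierstrassCurve.b₄, WeierstrassCurve.b₆, hW₁, hW₃, hW₂,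
      hW₄, hW₆, hμ]
    push_cast; ring
  have hα₄ : (shortModel W 1).a₄ = -((κ : ℚ) / 3) := by
    simp only [shortModel, hWc₄]; push_cast; ring
  have hα₆ : (shortModel W 1).a₆ = -((μ : ℚ) / 27) := by
    simp only [shortModel, hWc₆]; push_cast; ring
  have h3 : ‖((3 : ℕ) : ℚ_[2])⁻¹‖ = 1 := padicTwo_norm_inv_natCast_of_odd (by decide)
  have h27 : ‖((27 : ℕ) : ℚ_[2])⁻¹‖ = 1 := padicTwo_norm_inv_natCast_of_odd (by decide)
  have hrat : ∀ q : ℚ, algebraMap ℚ ℚ_[2] q = (q : ℚ_[2]) := fun q => by rw [eq_ratCast]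
  have hA : ‖algebraMap ℚ ℚ_[2] (shortModel W 1).a₄‖ ≤ 1 := by
    rw [hrat, hα₄]; push_cast
    rw [norm_neg, div_eq_mul_inv, norm_mul, show (3 : ℚ_[2]) = ((3 : ℕ) : ℚ_[2]) by norm_cast, h3, mul_one]
    exact Padic.norm_int_le_one κ
  have hB : ‖algebraMap ℚ ℚ_[2] (shortModel W 1).a₆‖ ≤ 1 := by
    rw [hrat, hα₆]; push_cast
    rw [norm_neg, div_eq_mul_inv, norm_mul, show (27 : ℚ_[2]) = ((27 : ℕ) : ℚ_[2]) by norm_cast, h27,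
      mul_one]
    exact Padic.norm_int_le_one μ
  set A₀ : ℤ_[2] := ⟨_, hA⟩ with hA₀
  set B₀ : ℤ_[2] := ⟨_, hB⟩ with hB₀
  set V : WeierstrassCurve ℤ_[2] := ⟨0, 0, 0, A₀, B₀⟩ with hVdef
  have hVE : V.map PadicInt.Coe.ringHom = (shortModel W 1).map (algebraMap ℚ ℚ_[2]) := by
    ext <;> simp [hVdef, shortModel, hA₀, hB₀]
  have hΔ1 : (shortModel W 1).Δ = W.Δ := by
    have hc := W.c_relation
    simp only [shortModel, WeierstrassCurve.Δ, WeierstrassCurve.b₂, WeierstrassCurve.b₄,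
      WeierstrassCurve.b₆, WeierstrassCurve.b₈, Int.cast_one, one_pow, one_mul] at hc ⊢
    simp only [WeierstrassCurve.c₄, WeierstrassCurve.c₆, WeierstrassCurve.b₂, WeierstrassCurve.b₄,
      WeierstrassCurve.b₆] at hc ⊢
    linear_combination (1 / 1728 : ℚ) * hc
  haveI hEll : (V.map PadicInt.Coe.ringHom).IsElliptic := by
    rw [hVE]
    refine ⟨?_⟩
    rw [map_Δ, hΔ1, isUnit_iff_ne_zero]
    exact (map_ne_zero _).mpr hWell.isUnit.ne_zero
  haveI hInt : (V.map PadicInt.Coe.ringHom).IsIntegral ℤ_[2] := V.isIntegral_map_coe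
  -- the 2-torsion abscissa `ε = e + b₂/12 = e + a₂/3` on `E♮`, a `2`-adic integer
  set eQ : ℚ := shortRoot W 1 e with heQ
  set e₂ : ℚ_[2] := algebraMap ℚ ℚ_[2] eQ with he₂
  have heQ' : eQ = (e : ℚ) + (a₂ : ℚ) / 3 := by
    rw [heQ, shortRoot, WeierstrassCurve.b₂, hW₁, hW₂]; push_cast; ring
  have heroot : eQ ^ 3 + (shortModel W 1).a₂ * eQ ^ 2 + (shortModel W 1).a₄ * eQ +
      (shortModel W 1).a₆ = 0 := shortRoot_one_isRoot W he
  have ha₂0 : (shortModel W 1).a₂ = 0 := rfl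
  have heroot₂ : e₂ ^ 3 + (V.a₄ : ℚ_[2]) * e₂ + (V.a₆ : ℚ_[2]) = 0 := by
    have h := congrArg (algebraMap ℚ ℚ_[2]) heroot
    simp only [map_add, map_mul, map_pow, map_zero, ha₂0, zero_mul, add_zero] at h
    exact h
  have henorm : ‖e₂‖ ≤ 1 :=
    padic_norm_le_one_of_cubic_root (A := (V.a₄ : ℚ_[2])) (B := (V.a₆ : ℚ_[2]))
      (PadicInt.norm_le_one _) (PadicInt.norm_le_one _) heroot₂
  set ε₀ : ℤ_[2] := ⟨e₂, henorm⟩ with hε₀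
  have hεroot : ε₀ ^ 3 + V.a₄ * ε₀ + V.a₆ = 0 := by
    rw [← PadicInt.coe_eq_zero]
    push_cast
    exact heroot₂
  -- §C: the germ, read on `E♮ ⊗ ℚ₂`
  set ι : ℚ⟦X⟧ →+* ℚ_[2]⟦X⟧ := PowerSeries.map (algebraMap ℚ ℚ_[2]) with hι
  set z₂ : ℚ_[2]⟦X⟧ := ι z with hz₂
  set L₂ : ℚ_[2]⟦X⟧ := ι (lSeriesLog a) with hL₂
  set D₂ : ℚ_[2]⟦X⟧ := C ((D.c : ℚ) : ℚ_[2]) * z₂ with hD₂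
  have hcz0 : constantCoeff (C (D.c : ℚ) * z) = 0 := by rw [map_mul, hz0, mul_zero]
  have hlog1 : (shortModel W 1).formalLog.subst (C (D.c : ℚ) * z) = C (D.c : ℚ) * lSeriesLog a := by
    have h := formalLog_shortModel_subst W hc0 hz0
    rw [hlog] at h
    have hcc : (C (D.c : ℚ) : ℚ⟦X⟧) * C (D.c : ℚ)⁻¹ = 1 := by
      rw [← map_mul, mul_inv_cancel₀ (Int.cast_ne_zero.mpr hc0), map_one]
    calc (shortModel W 1).formalLog.subst (C (D.c : ℚ) * z)
        = C (D.c : ℚ) * C (D.c : ℚ)⁻¹ * (shortModel W 1).formalLog.subst (C (D.c : ℚ) * z) := by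
          rw [hcc, one_mul]
      _ = C (D.c : ℚ) * lSeriesLog a := by rw [mul_assoc, ← h]
  have hz₂0 : constantCoeff z₂ = 0 := by
    rw [hz₂, hι, ← coeff_zero_eq_constantCoeff, coeff_map, coeff_zero_eq_constantCoeff, hz0, map_zero]
  have hD₂0 : constantCoeff D₂ = 0 := by rw [hD₂, map_mul, hz₂0, mul_zero]
  have hL₂0 : constantCoeff L₂ = 0 := by
    rw [hL₂, hι, ← coeff_zero_eq_constantCoeff, coeff_map, lSeriesLog, coeff_mk]; simp
  have hlog2 : (V.map PadicInt.Coe.ringHom).formalLog.subst D₂ = C ((D.c : ℚ) : ℚ_[2]) * L₂ := by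
    have h := congrArg ι hlog1
    rw [hι, map_subst_apply (HasSubst.of_constantCoeff_zero' hcz0), map_formalLog, ← hVE, map_mul,
      map_C, map_mul, map_C, hrat] at h
    exact h
  -- §D: integrality of the germ (`c L₂ ∈ ℤ₂⟦q⟧`, `exp_V ∈ ℤ₂⟦T⟧`)
  have hL₂int : IsPadicInt L₂ := by
    rw [isPadicInt_iff_coeff]
    intro n
    rw [hL₂, hι, coeff_map, lSeriesLog, coeff_mk, hrat]
    by_cases hn0 : n = 0
    · subst hn0; simp
    rcases Nat.even_or_odd n with hev | hodd
    · rw [han n, lFunction_eq_zero_of_even W ha2 hN2 hn0 (even_iff_two_dvd.mp hev)]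
      simp
    · push_cast
      rw [div_eq_mul_inv, norm_mul, padicTwo_norm_inv_natCast_of_odd hodd, mul_one]
      exact Padic.norm_int_le_one _
  have hu0 : constantCoeff (C ((D.c : ℚ) : ℚ_[2]) * L₂) = 0 := by rw [map_mul, hL₂0, mul_zero]
  have hDexp : D₂ = (V.map PadicInt.Coe.ringHom).formalExp.subst (C ((D.c : ℚ) : ℚ_[2]) * L₂) := by
    rw [← hlog2, formalExp_subst_formalLog_subst _ hD₂0]
  have hcint : IsPadicInt (C ((D.c : ℚ) : ℚ_[2]) : ℚ_[2]⟦X⟧) := by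
    rw [Rat.cast_intCast]
    exact IsPadicInt.powerSeries_C (Padic.norm_int_le_one _)
  have hDint : IsPadicInt D₂ := by
    rw [hDexp]
    exact (isPadicInt_formalExp_of_a₁_a₃_two V rfl rfl).powerSeries_subst (hcint.mul hL₂int)
      (HasSubst.of_constantCoeff_zero' hu0)
  obtain ⟨Dz, hDz⟩ := isPadicInt_iff_exists_powerSeries_map.mp hDint
  have hDz0 : constantCoeff Dz = 0 := by
    have h : (PadicInt.Coe.ringHom (p := 2)) (constantCoeff Dz) = 0 := by
      rw [← coeff_zero_eq_constantCoeff_apply, ← coeff_map, hDz, coeff_zero_eq_constantCoeff_apply, hD₂0]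
    exact PadicInt.coe_eq_zero.mp h
  have hsDz : HasSubst Dz := HasSubst.of_constantCoeff_zero' hDz0
  -- §E: the Kummer series on `E♮ ⊗ ℚ₂` and the chart identity composed with the germ
  have hΞ : ι (kummerSeries W D.c e z) =
      (V.map PadicInt.Coe.ringHom).formalXMulSq.subst D₂ - C e₂ * D₂ ^ 2 := by
    have h1 : ι ((shortModel W D.c).formalXMulSq.subst z) =
        (V.map PadicInt.Coe.ringHom).formalXMulSq.subst D₂ := by
      rw [formalXMulSq_shortModel_subst W hc0 hz0, hι,
        map_subst_apply (HasSubst.of_constantCoeff_zero' hcz0), map_formalXMulSq, ← hVE, map_mul, map_C,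
        hrat]
    have h2 : ι (shortRoot W D.c e • z ^ 2) = C e₂ * D₂ ^ 2 := by
      have hsc : algebraMap ℚ ℚ_[2] (shortRoot W D.c e) = e₂ * ((D.c : ℚ) : ℚ_[2]) ^ 2 := by
        rw [he₂, heQ, hrat, hrat]
        simp only [shortRoot]
        push_cast
        ring
      rw [smul_eq_C_mul, map_mul, map_pow, hι, map_C, hsc, hD₂]
      simp only [map_mul, map_pow]
      ring
    rw [kummerSeries, map_sub, h1, h2]
  set XV : ℤ_[2]⟦X⟧ := V.formalXMulSq with hXV
  set QV : ℤ_[2]⟦X⟧ := XV ^ 2 + C ε₀ * X ^ 2 * XV + C (ε₀ ^ 2 + V.a₄) * X ^ 4 with hQV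
  have hchart : (XV - C ε₀ * X ^ 2) * QV = XV ^ 2 :=
    formalXMulSq_sub_mul_quadratic_eq_sq V rfl rfl rfl hεroot
  -- read `κ(Dz) = Ξ`, all in `ℤ₂⟦q⟧` after mapping
  have hsD₂ : HasSubst D₂ := HasSubst.of_constantCoeff_zero' hD₂0
  have hκD : PowerSeries.map PadicInt.Coe.ringHom ((XV - C ε₀ * X ^ 2).subst Dz) =
      ι (kummerSeries W D.c e z) := by
    rw [hΞ, map_subst_apply hsDz, hDz, map_sub, subst_sub hsD₂, hXV, map_formalXMulSq, map_mul, map_C, map_pow,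
      map_X, subst_mul hsD₂, subst_pow hsD₂, Literature.NumberTheory.EllipticCurves.C_subst, subst_X hsD₂]
    rfl
  -- blindness read in `ℤ₂`: `2 ∣ ε`, `16 ∣ ε² − 4(ε² + a₄♮)`
  have hε₀Q : (ε₀ : ℚ_[2]) = ((e : ℚ) : ℚ_[2]) + ((a₂ : ℚ) : ℚ_[2]) / 3 := by
    change e₂ = _
    rw [he₂, heQ', hrat]; push_cast; ring
  have hA₀Q : (V.a₄ : ℚ_[2]) = ((a₄ : ℚ) : ℚ_[2]) - ((a₂ : ℚ) : ℚ_[2]) ^ 2 / 3 := by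
    change ((A₀ : ℤ_[2]) : ℚ_[2]) = _
    rw [hA₀]
    change algebraMap ℚ ℚ_[2] (shortModel W 1).a₄ = _
    rw [hrat, hα₄, hκ]; push_cast; ring
  have h3' : ‖((a₂ : ℚ) : ℚ_[2]) / 3‖ ≤ 1 := by
    have h3u : ‖((3 : ℚ_[2]))⁻¹‖ = 1 := by exact_mod_cast h3
    push_cast
    rw [div_eq_mul_inv, norm_mul, h3u, mul_one]
    exact Padic.norm_int_le_one _
  obtain ⟨⟨b', hb'⟩, ⟨k', hk'⟩⟩ := hbl
  have heb : e = b' + b' - a₂ := by linear_combination hb'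
  have h2n : ‖(2 : ℚ_[2])‖ < 1 := by
    have := Padic.norm_p_lt_one (p := 2); exact_mod_cast this
  have h2ε : (2 : ℤ_[2]) ∣ ε₀ := by
    have hlt : ‖ε₀‖ < 1 := by
      rw [PadicInt.norm_def, hε₀Q, heb]
      have hrw : (((b' + b' - a₂ : ℤ) : ℚ) : ℚ_[2]) + ((a₂ : ℚ) : ℚ_[2]) / 3 =
          2 * (((b' : ℚ) : ℚ_[2]) - ((a₂ : ℚ) : ℚ_[2]) / 3) := by
        push_cast; ring
      rw [hrw, norm_mul]
      have hm : ‖((b' : ℚ) : ℚ_[2]) - ((a₂ : ℚ) : ℚ_[2]) / 3‖ ≤ 1 := by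
        rw [sub_eq_add_neg]
        refine (Padic.nonarchimedean _ _).trans (max_le ?_ ?_)
        · push_cast; exact Padic.norm_int_le_one _
        · rw [norm_neg]; exact h3'
      calc ‖(2 : ℚ_[2])‖ * ‖((b' : ℚ) : ℚ_[2]) - ((a₂ : ℚ) : ℚ_[2]) / 3‖ ≤ ‖(2 : ℚ_[2])‖ * 1 := by gcongr
        _ < 1 := by rw [mul_one]; exact h2n
    have h := (PadicInt.norm_lt_one_iff_dvd ε₀).mp hlt
    exact_mod_cast h
  have h4c : ((4 : ℤ_[2]) : ℚ_[2]) = 4 := by exact_mod_cast (PadicInt.coe_natCast (p := 2) 4)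
  have h16 : (16 : ℤ_[2]) ∣ ε₀ ^ 2 - 4 * (ε₀ ^ 2 + V.a₄) := by
    have hval : (((ε₀ ^ 2 - 4 * (ε₀ ^ 2 + V.a₄) : ℤ_[2])) : ℚ_[2]) = 16 * (((k' : ℚ)) : ℚ_[2]) := by
      push_cast
      rw [h4c, hε₀Q, hA₀Q, heb]
      have hk : (((((a₂ + e) ^ 2 - 4 * (a₄ + (a₂ + e) * e) : ℤ)) : ℚ) : ℚ_[2]) =
          (((16 * k' : ℤ) : ℚ) : ℚ_[2]) := by rw [hk']
      rw [heb] at hk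
      push_cast at hk ⊢
      linear_combination hk
    have hle : ‖ε₀ ^ 2 - 4 * (ε₀ ^ 2 + V.a₄)‖ ≤ (2 : ℝ) ^ (-(4 : ℤ)) := by
      rw [PadicInt.norm_def, hval, norm_mul]
      have h16n : ‖(16 : ℚ_[2])‖ = (2 : ℝ) ^ (-(4 : ℤ)) := by
        rw [show (16 : ℚ_[2]) = ((2 : ℕ) : ℚ_[2]) ^ 4 by norm_num, norm_pow, Padic.norm_p]
        norm_num
      rw [h16n]
      calc (2 : ℝ) ^ (-(4 : ℤ)) * ‖(((k' : ℚ)) : ℚ_[2])‖ ≤ (2 : ℝ) ^ (-(4 : ℤ)) * 1 := by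
            gcongr; push_cast; exact Padic.norm_int_le_one _
        _ = (2 : ℝ) ^ (-(4 : ℤ)) := mul_one _
    have hmem := (PadicInt.norm_le_pow_iff_mem_span_pow _ 4).mp (by exact_mod_cast hle)
    rw [Ideal.mem_span_singleton] at hmem
    have h16eq : ((2 : ℕ) : ℤ_[2]) ^ 4 = 16 := by norm_num
    rw [h16eq] at hmem
    exact hmem
  -- `Q` is a square in `ℤ₂⟦t⟧`, so `κ·G² = X²`, read at the germ
  have hx0 : constantCoeff XV = 1 := V.constantCoeff_formalXMulSq
  obtain ⟨G, hG⟩ := isSquare_of_two_dvd_of_sixteen_dvd hx0 h2ε h16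
  have hκG : (XV - C ε₀ * X ^ 2) * (G * G) = XV ^ 2 := by rw [← hG]; exact hchart
  have hQ0 : constantCoeff (XV ^ 2 + C ε₀ * X ^ 2 * XV + C (ε₀ ^ 2 + V.a₄) * X ^ 4) = 1 := by
    simp [hx0]
  have hG0 : constantCoeff G ≠ 0 := by
    intro h0
    have h := congrArg constantCoeff hG
    rw [hQ0, map_mul, h0, mul_zero] at h
    exact one_ne_zero h
  refine ⟨XV.subst Dz, G.subst Dz, ?_, ?_⟩
  · intro h0
    have h := congrArg constantCoeff h0
    rw [Literature.RingTheory.FormalGroups.constantCoeff_subst_of_constantCoeff_eq_zero hDz0, map_zero] at h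
    exact hG0 h
  · rw [Subsingleton.elim (Rat.castHom ℚ_[2]) (algebraMap ℚ ℚ_[2])]
    change ι (kummerSeries W D.c e z) * _ = _
    have hch : PowerSeries.map PadicInt.Coe.ringHom (((XV - C ε₀ * X ^ 2) * (G * G)).subst Dz) =
        PowerSeries.map PadicInt.Coe.ringHom ((XV ^ 2).subst Dz) := by rw [hκG]
    rw [subst_mul hsDz, map_mul, hκD, subst_mul hsDz, map_mul, subst_pow hsDz, map_pow] at hch
    rw [sq, ← hch]

/-- **Blind ⟹ the certificate is silent**: at a Kummer-blind rational 2-torsion point every cuspidal Kummer representative has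
ALL `η`-exponents even (E-an-49⁺ + UFD step, as in E-an-52), whatever the Manin constant. [folklore] -/
theorem forall_even_etaExponent_of_kummerBlind
    (W : WeierstrassCurve ℚ) [W.IsElliptic] [W.IsGloballyMinimal] {N : ℕ} [NeZero N]
    (D : ModularParametrizationData W N) (a : ℕ → ℤ) (ha : ∀ n, (a n : ℂ) = cuspCoeff D.f n)
    (h4 : 4 ∣ N) (a₂ a₄ e : ℤ) (hW₁ : W.a₁ = 0) (hW₃ : W.a₃ = 0) (hW₂ : W.a₂ = a₂) (hW₄ : W.a₄ = a₄)
    (he : W.twoTorsionPolynomial.toPoly.IsRoot (e : ℚ)) (hbl : KummerBlindAtTwo a₂ a₄ e)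
    (z : ℚ⟦X⟧) (hz : IsParamGerm W D.c a z)
    (r : ℕ → ℤ) (g A B : ℤ⟦X⟧) (hrep : IsCuspidalKummerRep N (kummerSeries W D.c ((e : ℚ)) z) r g A B) :
    ∀ δ ∈ N.divisors, Even (r δ) := by
  obtain ⟨-, hEta, hB0, -, n₁, n₂, -, hEq⟩ := hrep
  obtain ⟨A', B', hB', hsq⟩ := isTwoAdicFracSquare_kummerSeries_of_kummerBlind W D a ha h4 a₂ a₄ e hW₁ hW₃ hW₂ hW₄ he
    z hz hbl
  set Ξ := kummerSeries W D.c e z with hΞ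
  have hcompat : ∀ P : ℤ⟦X⟧, PowerSeries.map (Rat.castHom ℚ_[2]) (PowerSeries.map (Int.castRingHom ℚ) P) =
      PowerSeries.map PadicInt.Coe.ringHom (PowerSeries.map (Int.castRingHom ℤ_[2]) P) := fun P => by
    rw [map_map_apply, map_map_apply,
      Subsingleton.elim ((Rat.castHom ℚ_[2]).comp (Int.castRingHom ℚ))
        ((PadicInt.Coe.ringHom (p := 2)).comp (Int.castRingHom ℤ_[2]))]
  have hκinj : Function.Injective (PowerSeries.map (PadicInt.Coe.ringHom (p := 2))) :=
    PowerSeries.map_injective _ (fun x y h => PadicInt.ext h)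
  have hιQinj : Function.Injective (PowerSeries.map (Int.castRingHom ℚ)) :=
    PowerSeries.map_injective _ (RingHom.injective_int _)
  have hιZinj : Function.Injective (PowerSeries.map (Int.castRingHom ℤ_[2])) :=
    PowerSeries.map_injective _ (RingHom.injective_int _)
  have hΞ0 : constantCoeff Ξ = 1 := by
    rw [hΞ, kummerSeries, map_sub,
      Literature.RingTheory.FormalGroups.constantCoeff_subst_of_constantCoeff_eq_zero hz.1,
      constantCoeff_formalXMulSq, smul_eq_C_mul, map_mul, map_pow, hz.1]
    simp
  have hΞne : Ξ ≠ 0 := fun h => by rw [h, map_zero] at hΞ0; exact zero_ne_one hΞ0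
  have hAne : A ≠ 0 := by
    intro hA
    rw [hA] at hEq
    simp only [zero_pow two_ne_zero, mul_zero, map_zero] at hEq
    rcases mul_eq_zero.mp hEq with h | h
    · rcases mul_eq_zero.mp h with h | h
      · exact hΞne h
      · exact hB0 (hιQinj (by rw [map_zero]; exact (pow_eq_zero_iff two_ne_zero).mp h))
    · exact X_ne_zero ((pow_eq_zero_iff' ).mp h).1
  set gZ : ℤ_[2]⟦X⟧ := PowerSeries.map (Int.castRingHom ℤ_[2]) g with hgZ
  set AZ : ℤ_[2]⟦X⟧ := PowerSeries.map (Int.castRingHom ℤ_[2]) A with hAZ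
  set BZ : ℤ_[2]⟦X⟧ := PowerSeries.map (Int.castRingHom ℤ_[2]) B with hBZ
  have hE1 : PowerSeries.map (Rat.castHom ℚ_[2]) Ξ * PowerSeries.map PadicInt.Coe.ringHom BZ ^ 2 * X ^ n₁ =
      X ^ n₂ * PowerSeries.map PadicInt.Coe.ringHom gZ * PowerSeries.map PadicInt.Coe.ringHom AZ ^ 2 := by
    have h := congrArg (PowerSeries.map (Rat.castHom ℚ_[2])) hEq
    simp only [map_mul, map_pow, PowerSeries.map_X, hcompat] at h
    exact h
  have hR : X ^ n₂ * gZ * (AZ * B') ^ 2 = X ^ n₁ * (A' * BZ) ^ 2 := by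
    apply hκinj
    simp only [map_mul, map_pow, PowerSeries.map_X]
    linear_combination (-(PowerSeries.map PadicInt.Coe.ringHom B') ^ 2) * hE1 +
      X ^ n₁ * (PowerSeries.map PadicInt.Coe.ringHom BZ) ^ 2 * hsq
  have hgU : IsUnit gZ := by
    rw [isUnit_iff_constantCoeff, hgZ, ← coeff_zero_eq_constantCoeff, coeff_map,
      coeff_zero_eq_constantCoeff, hEta.1, map_one]
    exact isUnit_one
  have hFne : AZ * B' ≠ 0 :=
    mul_ne_zero (fun h => hAne (hιZinj (by rw [map_zero]; exact h))) hB'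
  have hGne : A' * BZ ≠ 0 := by
    intro h0
    rw [h0, zero_pow two_ne_zero, mul_zero] at hR
    exact (mul_ne_zero (mul_ne_zero (pow_ne_zero _ X_ne_zero) hgU.ne_zero) (pow_ne_zero 2 hFne)) hR
  obtain ⟨F', G', hF', h'⟩ := exists_mul_sq_eq_sq_of_X_pow hgU hFne hGne hR
  have hsqg : IsSquare gZ := isSquare_of_mul_sq_eq_sq hF' h'
  have h0 : (0 : ℕ) ∉ N.divisors := fun h =>
    (NeZero.ne N) (Nat.eq_zero_of_zero_dvd (Nat.mem_divisors.mp h).1)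
  exact (EtaUnitSquareIffEven_holds N.divisors r g h0 hEta).mp hsqg

/-- **At ODD Manin constant, blind ⟺ parity vector zero** (an's conjectural dictionary E-an-51/54, MEMO-an §56.5 (iv), as a
theorem on the odd-`c` locus): for a rational 2-torsion point with a cuspidal Kummer representative on a curve with `4 ∣ N` and
`2 ∤ c`, `T` is Kummer-blind iff every `η`-exponent of the representative is even. [folklore] -/
theorem kummerBlindAtTwo_iff_forall_even_of_odd_maninConstant
    (W : WeierstrassCurve ℚ) [W.IsElliptic] [W.IsGloballyMinimal] {N : ℕ} [NeZero N]
    (D : ModularParametrizationData W N) (a : ℕ → ℤ) (ha : ∀ n, (a n : ℂ) = cuspCoeff D.f n)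
    (h4 : 4 ∣ N) (a₂ a₄ e : ℤ) (hW₁ : W.a₁ = 0) (hW₃ : W.a₃ = 0) (hW₂ : W.a₂ = a₂) (hW₄ : W.a₄ = a₄)
    (he : W.twoTorsionPolynomial.toPoly.IsRoot (e : ℚ))
    (z : ℚ⟦X⟧) (hz : IsParamGerm W D.c a z)
    (r : ℕ → ℤ) (g A B : ℤ⟦X⟧) (hrep : IsCuspidalKummerRep N (kummerSeries W D.c ((e : ℚ)) z) r g A B)
    (hcodd : ¬ (2 : ℤ) ∣ D.c) :
    KummerBlindAtTwo a₂ a₄ e ↔ ∀ δ ∈ N.divisors, Even (r δ) := by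
  constructor
  · intro hbl
    exact forall_even_etaExponent_of_kummerBlind W D a ha h4 a₂ a₄ e hW₁ hW₃ hW₂ hW₄ he hbl z hz r g A B hrep
  · intro hall
    by_contra hnb
    obtain ⟨δ, hδ, hodd⟩ := exists_odd_etaExponent_of_not_kummerBlind_of_odd_maninConstant W D a ha h4 a₂ a₄ e hW₁
      hW₃ hW₂ hW₄ he hnb z hz r g A B hrep hcodd
    exact (Int.not_even_iff_odd.mpr hodd) (hall δ hδ)

end Silent

end Summit.BirchSwinnertonDyer.BirchSwinnertonDyer.Theorems.ManinLocalTwoThree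

end
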